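/-
Origin: expansion seat `planner-pub-hodgecm-toy-g2-0`, handover #36 2026-08-18T10:34:49Z (`HOME/pub-hodgecm-toy-g2/lean/ToyG2/SplitEngine.lean`, md5 519dfa0c, 175 lines);
landed by the gen-7 packager in gate run 28 as `HodgeCM/Model/ToyG2/SplitEngine.lean` (import ^import ToyG2\.→import HodgeCM.Model.ToyG2. ×1).
-/
/-
# HodgeCM.Model.ToyG2.SplitEngine — producing `RightSplit` from one semisimple equivariant operator (G3, engine for E1–E4)

Generation 2 of the `pub-hodgecm-toy` lineage (seat `planner-pub-hodgecm-toy-g2-0`), DESIGN.md §9·UPDATE 10:30Z (route E1–E4).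
`HodgeRieszSplit` reduced Hodge–Riesz (hence `ModelAxioms`, hence G4: `G4FromSplits.SplitInput`) to the existence of a rational
complement of the right radical of `⋀⁴ × ⋀ʲ → ℚ` whose complexification is stable under the weight operators.  This file isolates
the abstract mechanism by which such complements are produced, so that generation 3 only has to verify problem-specific inputs:

* `TC X j T` — the complexification of a rational endomorphism `T` of `⋀ʲ H¹X`, transported to `⋀ʲ_ℂ` (`TC_theta`);
* `WC_TC_mem`, `WC_pow_mem`, `WC_aeval_mem` — `WC X j W` is stable under every polynomial in `TC` once `W` is `T`-stable;
* **`rightSplit_of_invariant`**: if `T` is semisimple (every `T`-stable subspace has a `T`-stable complement — e.g. Mathlib's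
  `Module.End.isSemisimple_iff`), the right radical is `T`-stable, and every weight operator `wt z j` is a polynomial in `TC`, then
  `∃ W, RightSplit X j W`;
* `compl_of_isSemisimple`, `rightSplit_of_isSemisimple`, `rightSplit_of_squarefree` — the same with Mathlib's `Module.End.IsSemisimple`,
  resp. a squarefree annihilating polynomial (`Module.End.isSemisimple_of_squarefree_aeval_eq_zero`), as the semisimplicity input;
* **`trRightRad_map_mem`**: the right radical is stable under `⋀ʲ g` for every automorphism `g` of `H¹X` under which the top trace
  is semi-invariant (`tr ∘ ⋀^{4+j} g = χ · tr`) — the form in which E2 (Hodge-torus points `α`, `α ᾱ ∈ ℚ`) delivers invariance;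
* `exists_aeval_eq_of_eigenbasis` — interpolation engine for the last input: an operator diagonal in a common eigenbasis with `TC`,
  whose eigenvalue is a function of the `TC`-eigenvalue, is a polynomial in `TC` (E3: the `wt z`-eigenvalue `z^{#(S ∩ Φ)}` of an
  eigen-monomial is a function of its Hodge-torus character);
* `hodgeRiesz_of_invariant` — the composite with `hodgeRiesz_of_rightSplit`.
-/
import Mathlib
import Summits.HodgeConjecture.HodgeCM.Model.ToyG2.HodgeRieszSplit

/-! PORT of `HodgeCM/Model/ToyG2/SplitEngine.lean` (HodgeCMPerL run 82) — verbatim mechanical port; provenance in the PORT header line. -/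

namespace HodgeCM.ToyG2

open HodgeCM.Toy HodgeCM.Toy.CMPresentation
open Literature.AlgebraicGeometry.Motives
open scoped TensorProduct
open exteriorPower Obj₂

noncomputable section

variable {X : Obj₂} {j : ℕ}

/-- complexification of a rational endomorphism of `⋀ʲ H¹X`, transported to `⋀ʲ_ℂ` along `Θ` -/
def TC (X : Obj₂) (j : ℕ) (T : ⋀[ℚ]^j X.L →ₗ[ℚ] ⋀[ℚ]^j X.L) : ⋀[ℂ]^j X.toObj.LC →ₗ[ℂ] ⋀[ℂ]^j X.toObj.LC :=
  (X.toObj.Θ j).toLinearMap ∘ₗ T.baseChange ℂ ∘ₗ (X.toObj.Θ j).symm.toLinearMap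

/-- (Ported verbatim from the HodgeCMPerL package; no docstring in the source.) -/
theorem TC_theta (T : ⋀[ℚ]^j X.L →ₗ[ℚ] ⋀[ℚ]^j X.L) (w : ⋀[ℚ]^j X.L) :
    TC X j T (X.toObj.Θ j ((1 : ℂ) ⊗ₜ[ℚ] w)) = X.toObj.Θ j ((1 : ℂ) ⊗ₜ[ℚ] T w) := by
  simp only [TC, LinearMap.coe_comp, Function.comp_apply, LinearEquiv.coe_coe, LinearEquiv.symm_apply_apply,
    LinearMap.baseChange_tmul]

/-- (Ported verbatim from the HodgeCMPerL package; no docstring in the source.) -/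
theorem WC_TC_mem {T : ⋀[ℚ]^j X.L →ₗ[ℚ] ⋀[ℚ]^j X.L} {W : Submodule ℚ (⋀[ℚ]^j X.L)} (hW : ∀ x ∈ W, T x ∈ W) :
    ∀ v ∈ WC X j W, TC X j T v ∈ WC X j W := by
  intro v hv
  have hle : WC X j W ≤ (WC X j W).comap (TC X j T) := by
    refine Submodule.span_le.2 ?_
    rintro _ ⟨w, rfl⟩
    show TC X j T (X.toObj.Θ j ((1 : ℂ) ⊗ₜ[ℚ] (w : ⋀[ℚ]^j X.L))) ∈ WC X j W
    rw [TC_theta]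
    exact Submodule.subset_span ⟨⟨T w, hW w w.2⟩, rfl⟩
  exact hle hv

/-- (Ported verbatim from the HodgeCMPerL package; no docstring in the source.) -/
theorem WC_pow_mem {T : ⋀[ℚ]^j X.L →ₗ[ℚ] ⋀[ℚ]^j X.L} {W : Submodule ℚ (⋀[ℚ]^j X.L)} (hW : ∀ x ∈ W, T x ∈ W) (n : ℕ) :
    ∀ v ∈ WC X j W, ((TC X j T) ^ n) v ∈ WC X j W := by
  induction n with
  | zero => intro v hv; rw [pow_zero, Module.End.one_apply]; exact hv
  | succ n ih => intro v hv; rw [pow_succ, Module.End.mul_apply]; exact ih _ (WC_TC_mem hW v hv)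

/-- (Ported verbatim from the HodgeCMPerL package; no docstring in the source.) -/
theorem WC_aeval_mem {T : ⋀[ℚ]^j X.L →ₗ[ℚ] ⋀[ℚ]^j X.L} {W : Submodule ℚ (⋀[ℚ]^j X.L)} (hW : ∀ x ∈ W, T x ∈ W)
    (p : Polynomial ℂ) : ∀ v ∈ WC X j W, Polynomial.aeval (TC X j T) p v ∈ WC X j W := by
  refine p.induction_on' (fun p q hp hq v hv => ?_) (fun n a v hv => ?_)
  · rw [map_add, LinearMap.add_apply]
    exact Submodule.add_mem _ (hp v hv) (hq v hv)
  · rw [Polynomial.aeval_monomial, Module.End.mul_apply, Module.algebraMap_end_apply]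
    exact Submodule.smul_mem _ _ (WC_pow_mem hW n v hv)

/-- **engine**: a semisimple rational operator preserving the right radical, of which every weight operator is a polynomial after
complexification, yields a weight-stable rational complement -/
theorem rightSplit_of_invariant (T : ⋀[ℚ]^j X.L →ₗ[ℚ] ⋀[ℚ]^j X.L)
    (hT : ∀ p : Submodule ℚ (⋀[ℚ]^j X.L), (∀ x ∈ p, T x ∈ p) →
      ∃ q : Submodule ℚ (⋀[ℚ]^j X.L), (∀ x ∈ q, T x ∈ q) ∧ IsCompl p q)
    (hR : ∀ x ∈ trRightRad X 4 j, T x ∈ trRightRad X 4 j)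
    (hwt : ∀ z : ℂ, ∃ p : Polynomial ℂ, X.toObj.wt z j = Polynomial.aeval (TC X j T) p) :
    ∃ W, RightSplit X j W := by
  obtain ⟨W, hWT, hc⟩ := hT _ hR
  refine ⟨W, hc, fun z v hv => ?_⟩
  obtain ⟨p, hp⟩ := hwt z
  rw [hp]
  exact WC_aeval_mem hWT p v hv


/-- Mathlib's semisimple endomorphisms supply the complement hypothesis of `rightSplit_of_invariant` -/
theorem compl_of_isSemisimple {T : ⋀[ℚ]^j X.L →ₗ[ℚ] ⋀[ℚ]^j X.L} (hT : Module.End.IsSemisimple T) :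
    ∀ p : Submodule ℚ (⋀[ℚ]^j X.L), (∀ x ∈ p, T x ∈ p) →
      ∃ q : Submodule ℚ (⋀[ℚ]^j X.L), (∀ x ∈ q, T x ∈ q) ∧ IsCompl p q := by
  intro p hp
  have hp' : p ∈ Module.End.invtSubmodule T := (Module.End.mem_invtSubmodule T).2 fun x hx => hp x hx
  obtain ⟨q, hq, hc⟩ := Module.End.isSemisimple_iff.1 hT p hp'
  exact ⟨q, fun x hx => (Module.End.mem_invtSubmodule T).1 hq hx, hc⟩

/-- `RightSplit` from a semisimple (Mathlib) operator preserving the radical, with the weight operators polynomial in it -/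
theorem rightSplit_of_isSemisimple (T : ⋀[ℚ]^j X.L →ₗ[ℚ] ⋀[ℚ]^j X.L) (hT : Module.End.IsSemisimple T)
    (hR : ∀ x ∈ trRightRad X 4 j, T x ∈ trRightRad X 4 j)
    (hwt : ∀ z : ℂ, ∃ p : Polynomial ℂ, X.toObj.wt z j = Polynomial.aeval (TC X j T) p) :
    ∃ W, RightSplit X j W :=
  rightSplit_of_invariant T (compl_of_isSemisimple hT) hR hwt

/-- `RightSplit` from an operator killed by a squarefree rational polynomial (e.g. one with a complex eigenbasis and separable
eigenvalue polynomial), preserving the radical, with the weight operators polynomial in it -/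
theorem rightSplit_of_squarefree (T : ⋀[ℚ]^j X.L →ₗ[ℚ] ⋀[ℚ]^j X.L) {q : Polynomial ℚ} (hq : Squarefree q)
    (hqT : Polynomial.aeval T q = 0)
    (hR : ∀ x ∈ trRightRad X 4 j, T x ∈ trRightRad X 4 j)
    (hwt : ∀ z : ℂ, ∃ p : Polynomial ℂ, X.toObj.wt z j = Polynomial.aeval (TC X j T) p) :
    ∃ W, RightSplit X j W :=
  rightSplit_of_isSemisimple T (Module.End.isSemisimple_of_squarefree_aeval_eq_zero hq hqT) hR hwt

/-- **invariance of the right radical** under `⋀ʲ g` for an automorphism `g` of `H¹X` with `tr ∘ ⋀^{4+j} g = χ · tr` -/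
theorem trRightRad_map_mem (g : X.L ≃ₗ[ℚ] X.L) (χ : ℚ)
    (hχ : ∀ x, trOf X (4 + j) (map (4 + j) (g : X.L →ₗ[ℚ] X.L) x) = χ * trOf X (4 + j) x)
    {c : ⋀[ℚ]^j X.L} (hc : c ∈ trRightRad X 4 j) : map j (g : X.L →ₗ[ℚ] X.L) c ∈ trRightRad X 4 j := by
  refine mem_trRightRad.2 fun y => ?_
  have hid : (g : X.L →ₗ[ℚ] X.L) ∘ₗ (g.symm : X.L →ₗ[ℚ] X.L) = LinearMap.id :=
    LinearMap.ext fun x => g.apply_symm_apply x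
  have hy : y = map 4 (g : X.L →ₗ[ℚ] X.L) (map 4 (g.symm : X.L →ₗ[ℚ] X.L) y) := by
    rw [← LinearMap.comp_apply, ← map_comp, hid, map_id, LinearMap.id_apply]
  rw [hy, ← map_wedge, hχ, (mem_trRightRad.1 hc) _, mul_zero]

/-- the same for the algebra generated: invariance under a finite composite / linear combination is inherited (closure under `+`, `∘`, scalars) -/
theorem trRightRad_invariant_add {T₁ T₂ : ⋀[ℚ]^j X.L →ₗ[ℚ] ⋀[ℚ]^j X.L}
    (h₁ : ∀ x ∈ trRightRad X 4 j, T₁ x ∈ trRightRad X 4 j) (h₂ : ∀ x ∈ trRightRad X 4 j, T₂ x ∈ trRightRad X 4 j) :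
    ∀ x ∈ trRightRad X 4 j, (T₁ + T₂) x ∈ trRightRad X 4 j := fun x hx => by
  rw [LinearMap.add_apply]
  exact Submodule.add_mem _ (h₁ x hx) (h₂ x hx)

/-- (Ported verbatim from the HodgeCMPerL package; no docstring in the source.) -/
theorem trRightRad_invariant_comp {T₁ T₂ : ⋀[ℚ]^j X.L →ₗ[ℚ] ⋀[ℚ]^j X.L}
    (h₁ : ∀ x ∈ trRightRad X 4 j, T₁ x ∈ trRightRad X 4 j) (h₂ : ∀ x ∈ trRightRad X 4 j, T₂ x ∈ trRightRad X 4 j) :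
    ∀ x ∈ trRightRad X 4 j, (T₁ ∘ₗ T₂) x ∈ trRightRad X 4 j := fun x hx => by
  rw [LinearMap.comp_apply]
  exact h₁ _ (h₂ x hx)


/-! ### polynomials in a diagonalisable operator (engine for E3) -/

/-- **interpolation engine**: if `T` and `S` are diagonal in a common basis and the `S`-eigenvalue is a function of the `T`-eigenvalue,
then `S` is a polynomial in `T` (Lagrange interpolation on the finite set of `T`-eigenvalues) -/
theorem exists_aeval_eq_of_eigenbasis {V : Type*} [AddCommGroup V] [Module ℂ V] {ι : Type*} [Fintype ι]
    (b : Module.Basis ι ℂ V) (T S : V →ₗ[ℂ] V) (lam mu : ι → ℂ)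
    (hT : ∀ i, T (b i) = lam i • b i) (hS : ∀ i, S (b i) = mu i • b i)
    (h : ∀ i i', lam i = lam i' → mu i = mu i') : ∃ p : Polynomial ℂ, S = Polynomial.aeval T p := by
  classical
  -- the eigenvalue function
  let f : ℂ → ℂ := fun x => if hx : ∃ i, lam i = x then mu hx.choose else 0
  have hf : ∀ i, f (lam i) = mu i := by
    intro i
    have hx : ∃ i', lam i' = lam i := ⟨i, rfl⟩
    simp only [f, dif_pos hx]
    exact h _ _ hx.choose_spec
  let s : Finset ℂ := Finset.univ.image lam
  refine ⟨Lagrange.interpolate s id f, b.ext fun i => ?_⟩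
  have hev : Module.End.HasEigenvector T (lam i) (b i) :=
    Module.End.hasEigenvector_iff.2 ⟨Module.End.mem_eigenspace_iff.2 (hT i), b.ne_zero i⟩
  rw [Module.End.aeval_apply_of_hasEigenvector hev, hS i]
  congr 1
  have hi : lam i ∈ s := Finset.mem_image_of_mem lam (Finset.mem_univ i)
  have he : Polynomial.eval (lam i) (Lagrange.interpolate s id f) = f (lam i) :=
    Lagrange.eval_interpolate_at_node (v := id) f (Set.injOn_id _) hi
  rw [he, hf]

/-- **G3 from the engine inputs** -/
theorem hodgeRiesz_of_invariant (hX : X.Good) (T : ⋀[ℚ]^(2 * (X.dim - 2)) X.L →ₗ[ℚ] ⋀[ℚ]^(2 * (X.dim - 2)) X.L)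
    (hT : ∀ p : Submodule ℚ (⋀[ℚ]^(2 * (X.dim - 2)) X.L), (∀ x ∈ p, T x ∈ p) →
      ∃ q : Submodule ℚ (⋀[ℚ]^(2 * (X.dim - 2)) X.L), (∀ x ∈ q, T x ∈ q) ∧ IsCompl p q)
    (hR : ∀ x ∈ trRightRad X 4 (2 * (X.dim - 2)), T x ∈ trRightRad X 4 (2 * (X.dim - 2)))
    (hwt : ∀ z : ℂ, ∃ p : Polynomial ℂ, X.toObj.wt z (2 * (X.dim - 2)) = Polynomial.aeval (TC X (2 * (X.dim - 2)) T) p) :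
    HodgeRiesz X := by
  obtain ⟨W, hW⟩ := rightSplit_of_invariant T hT hR hwt
  exact hodgeRiesz_of_rightSplit hX W hW

end

end HodgeCM.ToyG2
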